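import Mathlib
import Literature.NumberTheory.LFunctions.Zhang2022.SkeletonPartTwo
import HarnessLib

/-!
# Zhang (2022), typed skeleton XIV: Lemma 8.3 (iii) in the RELATIVE form that Appendix A yields

Topic `Literature/NumberTheory/LFunctions/Zhang2022` (Landau–Siegel audit tree; verdict-neutral).
Y. Zhang, *Discrete mean estimates and the Landau–Siegel zero*, arXiv:2211.02515v1 (2022)
[Zhang2022LandauSiegel] — **an unrefereed manuscript under adjudication; the `def … : Prop` below
is a CLAIM NODE, STATED NOT ASSERTED** (a named hypothesis for the whole-DAG theorem).

Why this file exists (campaign D-0069, gap row G-d55-3, L2-lead ruling R8 of 2026-08-25): Lemma 8.3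
(§8 p. 46) asserts in its last clause "`𝒰_j(d,r;s) = Π(d,r) + O(𝓛⁻⁸)` for `|s − 1| ≤ 5α`" with an
ABSOLUTE error; the Appendix-A proof ((A.1)–(A.3), per-prime factors `1 + O(α log q/q)`) yields only a
RELATIVE error `|Π(d,r)|·O(α𝓛)`, and `sup_{dr<PT⁻²}|Π(d,r)|` is not bounded (discharger sz-d55's
analysis, row G-d55-3). The banked node `Lemma83 c′` (printed, absolute form) stays the leaf of record
of the printed text; this file banks the RELATIVE form `Lemma83Rel c′` — the banked `Lemma83` verbatim
except that the last conjunct's bound `C𝓛⁻⁸` is multiplied by `∏_{q ∣ dr} (1 − q⁻¹)⁻¹` — as the ONE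
shared name the §8 dischargers (d21/d27/d55) consume and produce (Lemma 8.4's `O(𝓛⁻⁶)` absorbs the
relative error since `Π(d,r) ≪ dr/φ(dr) ≪ log 𝓛`). No implication between `Lemma83` and `Lemma83Rel`
is claimed here.

What is NOT asserted: Lemma 8.3 in either form. Nothing here bears on Theorems 1–2 of the source.

## References

* Y. Zhang, arXiv:2211.02515v1 (2022), §8 Lemma 8.3 (p. 46, tex L2389–2395), Appendix A
  (A.1)–(A.3) (pp. 101–102, tex L5008–5019). [cite: Zhang2022LandauSiegel, §8 Lemma 8.3]
-/

noncomputable section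

open Complex Real

namespace Literature.NumberTheory.LFunctions.Zhang2022.Skeleton

variable (c' : ℝ)

/-- **Lemma 8.3, relative form** (§8 p. 46 with the error term Appendix A actually delivers): for
`dr < PT⁻²`, `1 ≤ j ≤ 3`, the function `𝒰_j(d,r;s) = L(s,χ)/(L(s+β_{j+1},χ)L(s+β_{j+2},χ))·Σ_m χ(m)ξ₀ⱼ(m;d,r)m^{−s}`
(i) continues analytically to `σ > 9/10`, (ii) satisfies `𝒰 ≪ ∏_{q∣dr}(1 + Cq^{−σ})` there, and
(iii′) `|𝒰_j(d,r;s) − Π(d,r)| ≤ C𝓛⁻⁸·∏_{q∣dr}(1 − q⁻¹)⁻¹` for `|s − 1| ≤ 5α` — the banked `Lemma83 c′`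
verbatim except for the factor `∏_{q∣dr}(1 − q⁻¹)⁻¹` in (iii′). CLAIM, stated not asserted
(gap row G-d55-3). [cite: Zhang2022LandauSiegel, §8 Lemma 8.3] -/
def Lemma83Rel : Prop :=
  ∃ C : ℝ, ForAllLarge fun D _ χ => AssumptionA D χ →
    ∀ j ∈ ({1, 2, 3} : Finset ℕ), ∀ d r : ℕ, 1 ≤ d → 1 ≤ r → ((d * r : ℕ) : ℝ) < bigP D / bigT D ^ 2 →
      ∃ U : ℂ → ℂ, DifferentiableOn ℂ U {s : ℂ | 9 / 10 < s.re} ∧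
        (∀ s : ℂ, 1 < s.re → U s = χ.LFunction s /
            (χ.LFunction (s + betaJ c' D (j + 1)) * χ.LFunction (s + betaJ c' D (j + 2))) *
              xiSeries c' χ j d r s) ∧
        (∀ s : ℂ, 9 / 10 < s.re →
          ‖U s‖ ≤ C * ∏ q ∈ (d * r).primeFactors, (1 + C * (q : ℝ) ^ (-s.re))) ∧
        (∀ s : ℂ, ‖s - 1‖ ≤ 5 * alpha D →
          ‖U s - PiW χ d r‖ ≤ C * (ell D ^ 8)⁻¹ * ∏ q ∈ (d * r).primeFactors, (1 - (q : ℝ)⁻¹)⁻¹)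

/-- The printed (absolute) Lemma 8.3 implies the relative form: `∏_{q∣dr}(1 − q⁻¹)⁻¹ ≥ 1`.
(So discharging the banked `Lemma83` also closes `Lemma83Rel`; the converse is not claimed.)
[cite: Zhang2022LandauSiegel, §8 Lemma 8.3] -/
theorem lemma83Rel_of_lemma83 {c' : ℝ} (h : Lemma83 c') : Lemma83Rel c' := by
  obtain ⟨C, hC⟩ := h
  refine ⟨|C|, hC.mono fun D _ χ _ _ hS hA j hj d r hd hr hdr => ?_⟩
  obtain ⟨U, hU, hU1, hU2, hU3⟩ := hS hA j hj d r hd hr hdr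
  have hprod : 1 ≤ ∏ q ∈ (d * r).primeFactors, (1 - (q : ℝ)⁻¹)⁻¹ := by
    refine le_of_eq_of_le (Finset.prod_const_one (s := (d * r).primeFactors)).symm
      (Finset.prod_le_prod (fun _ _ => zero_le_one) fun q hq => ?_)
    have hq2 : (2 : ℝ) ≤ q := by exact_mod_cast (Nat.prime_of_mem_primeFactors hq).two_le
    have h1 : 0 < 1 - (q : ℝ)⁻¹ := by
      have : (q : ℝ)⁻¹ ≤ 1 / 2 := by rw [inv_eq_one_div]; gcongr
      linarith
    have h2 : 1 - (q : ℝ)⁻¹ ≤ 1 := by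
      have : 0 ≤ (q : ℝ)⁻¹ := by positivity
      linarith
    exact (one_le_inv₀ h1).mpr h2
  refine ⟨U, hU, hU1, fun s hs => ?_, fun s hs => ?_⟩
  · calc ‖U s‖ ≤ C * ∏ q ∈ (d * r).primeFactors, (1 + C * (q : ℝ) ^ (-s.re)) := hU2 s hs
      _ ≤ |C * ∏ q ∈ (d * r).primeFactors, (1 + C * (q : ℝ) ^ (-s.re))| := le_abs_self _
      _ = |C| * ∏ q ∈ (d * r).primeFactors, |1 + C * (q : ℝ) ^ (-s.re)| := by
          rw [abs_mul, Finset.abs_prod]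
      _ ≤ |C| * ∏ q ∈ (d * r).primeFactors, (1 + |C| * (q : ℝ) ^ (-s.re)) := by
          refine mul_le_mul_of_nonneg_left ?_ (abs_nonneg C)
          refine Finset.prod_le_prod (fun _ _ => abs_nonneg _) fun q _ => ?_
          calc |1 + C * (q : ℝ) ^ (-s.re)| ≤ |(1 : ℝ)| + |C * (q : ℝ) ^ (-s.re)| := abs_add_le _ _
            _ = 1 + |C| * (q : ℝ) ^ (-s.re) := by
                rw [abs_one, abs_mul, abs_of_nonneg (Real.rpow_nonneg (Nat.cast_nonneg q) _)]
  · have hℓ : 0 ≤ (ell D ^ 8)⁻¹ := by positivity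
    calc ‖U s - PiW χ d r‖ ≤ C * (ell D ^ 8)⁻¹ := hU3 s hs
      _ ≤ |C| * (ell D ^ 8)⁻¹ := by gcongr; exact le_abs_self _
      _ = |C| * (ell D ^ 8)⁻¹ * 1 := (mul_one _).symm
      _ ≤ |C| * (ell D ^ 8)⁻¹ * ∏ q ∈ (d * r).primeFactors, (1 - (q : ℝ)⁻¹)⁻¹ := by
          gcongr

end Literature.NumberTheory.LFunctions.Zhang2022.Skeleton
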